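import Mathlib
import Summits.Ventures.PercRepro2.TypedTwoEdgesAtOKernel

/-!
# Two typed edges at `o`, II: the deletion–contraction identity behind the `o`-star classes
(blind cell PercRepro2, night-3 g16, 2026-08-27; the algebraic form of NIGHT3-CERT.md §24.4)

For the kernel `K₃` of (HCOV) on every finite graph, marking and pinning: if the mark `o` carries
exactly two typed edges `e = {o, u}`, `f = {o, v}`, both of type `1`, every other edge at `o` being
pinned closed and untyped, then (`typedCount_two_edges_at_o`)

  `N_τ = D₂ + 2 · N_τ(F ∖ e, e pinned closed) + 2 · N_τ(F ∖ f, f pinned closed)`,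

where `D₂` (`doubleClass`) is the sum of the three SAME-COLOUR classes (both edges carried by one
copy, `o` merging the clusters of `u` and `v` there) and the two deletion counts are the instances
with `o` pendant at `v`, resp. at `u`.  Mechanism: in a colouring carrying `e` in copy `i` and `f`
in copy `j ≠ i` the kernel is the sum of the kernel with `e` alone in copy `i` and the kernel with
`f` alone in copy `j` (`TypedTwoEdgesAtOKernel.lean`), so the six mixed colourings contribute each
single attachment twice, and the single attachments of one edge sum to the count with the other
edge deleted (`typedCount_split`).  Consequently (`doubleClass_eq`) the double-attachment class is
`D₂ = N_τ − 2 N_τ(−e) − 2 N_τ(−f)`: the `o`-star class sums of the typed count are determined by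
three symmetric typed counts, and the superadditivity `N_τ ≥ 2 N_τ(−e) + 2 N_τ(−f)` IS the
nonnegativity of the double-attachment class (the statement NEG-191 refutes at `|F| = 9`: on its
witness `N = 34`, `N(−e) = 18`, `N(−f) = 0`, `D₂ = −2`).  Own work; standard axioms.
-/

namespace Summit.Ventures.PercRepro2

namespace CovForm

namespace TypedRed

open OneTyped

/-! ## The deletion–contraction identity at `o` -/

section Main

open Classical

variable {V : Type*} {E : Type*} [Fintype E] [DecidableEq E] {R : Type*} [Field R]

variable (ends : E → Sym2 V) (o a₁ a₂ a₃ b : V)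

/-- Abbreviation: the copy with `e` at `p` and `f` at `p'` (the order of the updates is the one
produced by splitting the typed count first at `e`, then at `f`). -/
abbrev upd2 (x : Config E) (e f : E) (p p' : Bool) : Config E :=
  Function.update (Function.update x f p') e p

/-- The count over `F ∖ {e, f}` (both pinned closed) of the kernel with the copies re-opened at
`e` and `f` as prescribed: `(p, p')` for copy `1`, `(q, q')` for copy `2`, `(r, r')` for copy `3`. -/
noncomputable def term (F : Finset E) (z : Config E) (τ : E → ℕ) (e f : E)
    (K : Config E → Config E → Config E → R) (p p' q q' r r' : Bool) : R :=
  typedCount ((F.erase e).erase f) (Function.update (Function.update z e false) f false) τ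
    (fun x y w => K (upd2 x e f p p') (upd2 y e f q q') (upd2 w e f r r'))

/-- **The double-attachment part**: the three same-colour classes (both edges at `o` carried by
copy `1`, by copy `2`, by copy `3`). -/
noncomputable def doubleClass (F : Finset E) (z : Config E) (τ : E → ℕ) (e f : E)
    (K : Config E → Config E → Config E → R) : R :=
  term F z τ e f K true true false false false false + term F z τ e f K false false true true false false +
    term F z τ e f K false false false false true true

omit [Fintype E] in
/-- On the support of the count over `F ∖ {e, f}`, a copy has `e`, `f` and every other edge at `o`
closed. -/
lemma support_closed {e f : E} (F : Finset E) (z : Config E)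
    (hcl : ∀ e', e' ≠ e → e' ≠ f → o ∈ ends e' → e' ∉ F ∧ z e' = false) (hef : e ≠ f)
    (x : Config E)
    (hx : ∀ e', e' ∉ (F.erase e).erase f →
      x e' = Function.update (Function.update z e false) f false e') :
    (∀ e', e' ≠ e → e' ≠ f → o ∈ ends e' → x e' = false) ∧ x e = false ∧ x f = false := by
  refine ⟨fun e' he' hf' ho => ?_, ?_, ?_⟩
  · obtain ⟨hF, hz⟩ := hcl e' he' hf' ho
    rw [hx e' (fun h => hF (Finset.mem_of_mem_erase (Finset.mem_of_mem_erase h))),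
      Function.update_of_ne hf', Function.update_of_ne he']
    exact hz
  · rw [hx e (fun h => Finset.notMem_erase e F (Finset.mem_of_mem_erase h)),
      Function.update_of_ne hef, Function.update_self]
  · rw [hx f (Finset.notMem_erase f _), Function.update_self]

/-- **Two typed edges at `o` (both of type `1`)**: with `e = {o, u}`, `f = {o, v}` typed of type
`1` and every other edge at `o` pinned closed and untyped,
`N_τ = D₂ + 2 · N_τ(F ∖ e, e pinned closed) + 2 · N_τ(F ∖ f, f pinned closed)`, where `D₂` is the
sum of the three same-colour classes (`doubleClass`). -/
theorem typedCount_two_edges_at_o {e f : E} {u v : V} (he : ends e = s(o, u))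
    (hf : ends f = s(o, v)) (hou : o ≠ u) (hov : o ≠ v) (hef : e ≠ f) (ho1 : o ≠ a₁) (ho2 : o ≠ a₂)
    (ho3 : o ≠ a₃) (hob : o ≠ b) (F : Finset E) (heF : e ∈ F) (hfF : f ∈ F) (z : Config E)
    (τ : E → ℕ) (hτe : τ e = 1) (hτf : τ f = 1)
    (hcl : ∀ e', e' ≠ e → e' ≠ f → o ∈ ends e' → e' ∉ F ∧ z e' = false) :
    typedCount F z τ (K3 ends o a₁ a₂ a₃ b : Config E → Config E → Config E → R) =
      doubleClass F z τ e f (K3 ends o a₁ a₂ a₃ b) +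
        2 * typedCount (F.erase e) (Function.update z e false) τ (K3 ends o a₁ a₂ a₃ b) +
        2 * typedCount (F.erase f) (Function.update z f false) τ (K3 ends o a₁ a₂ a₃ b) := by
  set K : Config E → Config E → Config E → R := K3 ends o a₁ a₂ a₃ b with hK
  have hfe : f ∈ F.erase e := Finset.mem_erase.2 ⟨hef.symm, hfF⟩
  have hef' : e ∈ F.erase f := Finset.mem_erase.2 ⟨hef, heF⟩
  -- the nine-term expansion
  have h1 : typedCount F z τ K =
      typedCount (F.erase e) (Function.update z e false) τ
        (fun x y w => K (Function.update x e true) (Function.update y e false)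
          (Function.update w e false)) +
      typedCount (F.erase e) (Function.update z e false) τ
        (fun x y w => K (Function.update x e false) (Function.update y e true)
          (Function.update w e false)) +
      typedCount (F.erase e) (Function.update z e false) τ
        (fun x y w => K (Function.update x e false) (Function.update y e false)
          (Function.update w e true)) := by
    rw [typedCount_split F e heF, hτe, sum_bool3_one]
  have hA : typedCount (F.erase e) (Function.update z e false) τ
      (fun x y w => K (Function.update x e true) (Function.update y e false)
        (Function.update w e false)) =
      term F z τ e f K true true false false false false +
        term F z τ e f K true false false true false false +
        term F z τ e f K true false false false false true := by
    rw [typedCount_split (F.erase e) f hfe, hτf, sum_bool3_one]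
    rfl
  have hB : typedCount (F.erase e) (Function.update z e false) τ
      (fun x y w => K (Function.update x e false) (Function.update y e true)
        (Function.update w e false)) =
      term F z τ e f K false true true false false false +
        term F z τ e f K false false true true false false +
        term F z τ e f K false false true false false true := by
    rw [typedCount_split (F.erase e) f hfe, hτf, sum_bool3_one]
    rfl
  have hC : typedCount (F.erase e) (Function.update z e false) τ
      (fun x y w => K (Function.update x e false) (Function.update y e false)
        (Function.update w e true)) =
      term F z τ e f K false true false false true false +
        term F z τ e f K false false false true true false +
        term F z τ e f K false false false false true true := by
    rw [typedCount_split (F.erase e) f hfe, hτf, sum_bool3_one]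
    rfl
  -- the six mixed colourings are additive
  have hm12 : term F z τ e f K true false false true false false =
      term F z τ e f K true false false false false false +
        term F z τ e f K false false false true false false := by
    unfold term
    rw [← typedCount_add]
    refine typedCount_congr_K_on _ _ _ fun x y w hxyw _ => ?_
    exact K3_mixed12 ends o a₁ a₂ a₃ b he hf hou hov hef ho1 ho2 ho3 hob
      (support_closed ends o F z hcl hef x fun e' he' => (hxyw e' he').1).1
      (support_closed ends o F z hcl hef y fun e' he' => (hxyw e' he').2.1).1
      (support_closed ends o F z hcl hef w fun e' he' => (hxyw e' he').2.2).1
  have hm13 : term F z τ e f K true false false false false true =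
      term F z τ e f K true false false false false false +
        term F z τ e f K false false false false false true := by
    unfold term
    rw [← typedCount_add]
    refine typedCount_congr_K_on _ _ _ fun x y w hxyw _ => ?_
    exact K3_mixed13 ends o a₁ a₂ a₃ b he hf hou hov hef ho1 ho2 ho3 hob
      (support_closed ends o F z hcl hef x fun e' he' => (hxyw e' he').1).1
      (support_closed ends o F z hcl hef y fun e' he' => (hxyw e' he').2.1).1
      (support_closed ends o F z hcl hef w fun e' he' => (hxyw e' he').2.2).1
  have hm21 : term F z τ e f K false true true false false false =
      term F z τ e f K false false true false false false +
        term F z τ e f K false true false false false false := by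
    unfold term
    rw [← typedCount_add]
    refine typedCount_congr_K_on _ _ _ fun x y w hxyw _ => ?_
    exact K3_mixed21 ends o a₁ a₂ a₃ b he hf hou hov hef ho1 ho2 ho3 hob
      (support_closed ends o F z hcl hef x fun e' he' => (hxyw e' he').1).1
      (support_closed ends o F z hcl hef y fun e' he' => (hxyw e' he').2.1).1
      (support_closed ends o F z hcl hef w fun e' he' => (hxyw e' he').2.2).1
  have hm23 : term F z τ e f K false false true false false true =
      term F z τ e f K false false true false false false +
        term F z τ e f K false false false false false true := by
    unfold term
    rw [← typedCount_add]
    refine typedCount_congr_K_on _ _ _ fun x y w hxyw _ => ?_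
    exact K3_mixed23 ends o a₁ a₂ a₃ b he hf hou hov hef ho1 ho2 ho3 hob
      (support_closed ends o F z hcl hef x fun e' he' => (hxyw e' he').1).1
      (support_closed ends o F z hcl hef y fun e' he' => (hxyw e' he').2.1).1
      (support_closed ends o F z hcl hef w fun e' he' => (hxyw e' he').2.2).1
  have hm31 : term F z τ e f K false true false false true false =
      term F z τ e f K false false false false true false +
        term F z τ e f K false true false false false false := by
    unfold term
    rw [← typedCount_add]
    refine typedCount_congr_K_on _ _ _ fun x y w hxyw _ => ?_
    exact K3_mixed31 ends o a₁ a₂ a₃ b he hf hou hov hef ho1 ho2 ho3 hob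
      (support_closed ends o F z hcl hef x fun e' he' => (hxyw e' he').1).1
      (support_closed ends o F z hcl hef y fun e' he' => (hxyw e' he').2.1).1
      (support_closed ends o F z hcl hef w fun e' he' => (hxyw e' he').2.2).1
  have hm32 : term F z τ e f K false false false true true false =
      term F z τ e f K false false false false true false +
        term F z τ e f K false false false true false false := by
    unfold term
    rw [← typedCount_add]
    refine typedCount_congr_K_on _ _ _ fun x y w hxyw _ => ?_
    exact K3_mixed32 ends o a₁ a₂ a₃ b he hf hou hov hef ho1 ho2 ho3 hob
      (support_closed ends o F z hcl hef x fun e' he' => (hxyw e' he').1).1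
      (support_closed ends o F z hcl hef y fun e' he' => (hxyw e' he').2.1).1
      (support_closed ends o F z hcl hef w fun e' he' => (hxyw e' he').2.2).1
  -- the single attachments, as counts of the kernel re-opened at one edge only
  have s1 : term F z τ e f K true false false false false false =
      typedCount ((F.erase e).erase f) (Function.update (Function.update z e false) f false) τ
        (fun x y w => K (Function.update x e true) (Function.update y e false)
          (Function.update w e false)) := by
    unfold term
    refine typedCount_congr_K_on _ _ _ fun x y w hxyw _ => ?_
    have hx := (support_closed ends o F z hcl hef x fun e' he' => (hxyw e' he').1).2.2
    have hy := (support_closed ends o F z hcl hef y fun e' he' => (hxyw e' he').2.1).2.2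
    have hw := (support_closed ends o F z hcl hef w fun e' he' => (hxyw e' he').2.2).2.2
    have hx' : Function.update x f false = x := Function.update_eq_self_iff.2 hx.symm
    have hy' : Function.update y f false = y := Function.update_eq_self_iff.2 hy.symm
    have hw' : Function.update w f false = w := Function.update_eq_self_iff.2 hw.symm
    simp only [upd2, hx', hy', hw']
  have s2 : term F z τ e f K false false true false false false =
      typedCount ((F.erase e).erase f) (Function.update (Function.update z e false) f false) τ
        (fun x y w => K (Function.update x e false) (Function.update y e true)
          (Function.update w e false)) := by
    unfold term
    refine typedCount_congr_K_on _ _ _ fun x y w hxyw _ => ?_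
    have hx := (support_closed ends o F z hcl hef x fun e' he' => (hxyw e' he').1).2.2
    have hy := (support_closed ends o F z hcl hef y fun e' he' => (hxyw e' he').2.1).2.2
    have hw := (support_closed ends o F z hcl hef w fun e' he' => (hxyw e' he').2.2).2.2
    have hx' : Function.update x f false = x := Function.update_eq_self_iff.2 hx.symm
    have hy' : Function.update y f false = y := Function.update_eq_self_iff.2 hy.symm
    have hw' : Function.update w f false = w := Function.update_eq_self_iff.2 hw.symm
    simp only [upd2, hx', hy', hw']
  have s3 : term F z τ e f K false false false false true false =
      typedCount ((F.erase e).erase f) (Function.update (Function.update z e false) f false) τ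
        (fun x y w => K (Function.update x e false) (Function.update y e false)
          (Function.update w e true)) := by
    unfold term
    refine typedCount_congr_K_on _ _ _ fun x y w hxyw _ => ?_
    have hx := (support_closed ends o F z hcl hef x fun e' he' => (hxyw e' he').1).2.2
    have hy := (support_closed ends o F z hcl hef y fun e' he' => (hxyw e' he').2.1).2.2
    have hw := (support_closed ends o F z hcl hef w fun e' he' => (hxyw e' he').2.2).2.2
    have hx' : Function.update x f false = x := Function.update_eq_self_iff.2 hx.symm
    have hy' : Function.update y f false = y := Function.update_eq_self_iff.2 hy.symm
    have hw' : Function.update w f false = w := Function.update_eq_self_iff.2 hw.symm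
    simp only [upd2, hx', hy', hw']
  have hxe : ∀ (x : Config E) (p : Bool), x e = false → Function.update x f p e = false :=
    fun x p hx => by rw [Function.update_of_ne hef]; exact hx
  have t1 : term F z τ e f K false true false false false false =
      typedCount ((F.erase e).erase f) (Function.update (Function.update z e false) f false) τ
        (fun x y w => K (Function.update x f true) (Function.update y f false)
          (Function.update w f false)) := by
    unfold term
    refine typedCount_congr_K_on _ _ _ fun x y w hxyw _ => ?_
    have hx := (support_closed ends o F z hcl hef x fun e' he' => (hxyw e' he').1).2.1
    have hy := (support_closed ends o F z hcl hef y fun e' he' => (hxyw e' he').2.1).2.1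
    have hw := (support_closed ends o F z hcl hef w fun e' he' => (hxyw e' he').2.2).2.1
    have hx' : Function.update (Function.update x f true) e false = Function.update x f true :=
      Function.update_eq_self_iff.2 (hxe x _ hx).symm
    have hy' : Function.update (Function.update y f false) e false = Function.update y f false :=
      Function.update_eq_self_iff.2 (hxe y _ hy).symm
    have hw' : Function.update (Function.update w f false) e false = Function.update w f false :=
      Function.update_eq_self_iff.2 (hxe w _ hw).symm
    simp only [upd2, hx', hy', hw']
  have t2 : term F z τ e f K false false false true false false =
      typedCount ((F.erase e).erase f) (Function.update (Function.update z e false) f false) τ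
        (fun x y w => K (Function.update x f false) (Function.update y f true)
          (Function.update w f false)) := by
    unfold term
    refine typedCount_congr_K_on _ _ _ fun x y w hxyw _ => ?_
    have hx := (support_closed ends o F z hcl hef x fun e' he' => (hxyw e' he').1).2.1
    have hy := (support_closed ends o F z hcl hef y fun e' he' => (hxyw e' he').2.1).2.1
    have hw := (support_closed ends o F z hcl hef w fun e' he' => (hxyw e' he').2.2).2.1
    have hx' : Function.update (Function.update x f false) e false = Function.update x f false :=
      Function.update_eq_self_iff.2 (hxe x _ hx).symm
    have hy' : Function.update (Function.update y f true) e false = Function.update y f true :=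
      Function.update_eq_self_iff.2 (hxe y _ hy).symm
    have hw' : Function.update (Function.update w f false) e false = Function.update w f false :=
      Function.update_eq_self_iff.2 (hxe w _ hw).symm
    simp only [upd2, hx', hy', hw']
  have t3 : term F z τ e f K false false false false false true =
      typedCount ((F.erase e).erase f) (Function.update (Function.update z e false) f false) τ
        (fun x y w => K (Function.update x f false) (Function.update y f false)
          (Function.update w f true)) := by
    unfold term
    refine typedCount_congr_K_on _ _ _ fun x y w hxyw _ => ?_
    have hx := (support_closed ends o F z hcl hef x fun e' he' => (hxyw e' he').1).2.1
    have hy := (support_closed ends o F z hcl hef y fun e' he' => (hxyw e' he').2.1).2.1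
    have hw := (support_closed ends o F z hcl hef w fun e' he' => (hxyw e' he').2.2).2.1
    have hx' : Function.update (Function.update x f false) e false = Function.update x f false :=
      Function.update_eq_self_iff.2 (hxe x _ hx).symm
    have hy' : Function.update (Function.update y f false) e false = Function.update y f false :=
      Function.update_eq_self_iff.2 (hxe y _ hy).symm
    have hw' : Function.update (Function.update w f true) e false = Function.update w f true :=
      Function.update_eq_self_iff.2 (hxe w _ hw).symm
    simp only [upd2, hx', hy', hw']
  -- the single attachments of `e` (f pinned closed) sum to the count with `f` deleted
  have hE : typedCount (F.erase f) (Function.update z f false) τ K =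
      term F z τ e f K true false false false false false +
        term F z τ e f K false false true false false false +
        term F z τ e f K false false false false true false := by
    rw [typedCount_split (F.erase f) e hef', hτe, sum_bool3_one, Finset.erase_right_comm,
      Function.update_comm hef.symm, s1, s2, s3]
  -- the single attachments of `f` (e pinned closed) sum to the count with `e` deleted
  have hF : typedCount (F.erase e) (Function.update z e false) τ K =
      term F z τ e f K false true false false false false +
        term F z τ e f K false false false true false false +
        term F z τ e f K false false false false false true := by
    rw [typedCount_split (F.erase e) f hfe, hτf, sum_bool3_one, t1, t2, t3]
  -- assemble
  rw [h1, hA, hB, hC, hm12, hm13, hm21, hm23, hm31, hm32, hE, hF]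
  unfold doubleClass
  ring

/-- **The double-attachment class as the superadditivity defect**:
`D₂ = N_τ − 2 N_τ(F ∖ e) − 2 N_τ(F ∖ f)`. -/
theorem doubleClass_eq {e f : E} {u v : V} (he : ends e = s(o, u))
    (hf : ends f = s(o, v)) (hou : o ≠ u) (hov : o ≠ v) (hef : e ≠ f) (ho1 : o ≠ a₁) (ho2 : o ≠ a₂)
    (ho3 : o ≠ a₃) (hob : o ≠ b) (F : Finset E) (heF : e ∈ F) (hfF : f ∈ F) (z : Config E)
    (τ : E → ℕ) (hτe : τ e = 1) (hτf : τ f = 1)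
    (hcl : ∀ e', e' ≠ e → e' ≠ f → o ∈ ends e' → e' ∉ F ∧ z e' = false) :
    doubleClass F z τ e f (K3 ends o a₁ a₂ a₃ b : Config E → Config E → Config E → R) =
      typedCount F z τ (K3 ends o a₁ a₂ a₃ b : Config E → Config E → Config E → R) -
        2 * typedCount (F.erase e) (Function.update z e false) τ (K3 ends o a₁ a₂ a₃ b) -
        2 * typedCount (F.erase f) (Function.update z f false) τ (K3 ends o a₁ a₂ a₃ b) := by
  have h := typedCount_two_edges_at_o (R := R) ends o a₁ a₂ a₃ b he hf hou hov hef ho1 ho2 ho3 hob F heF hfF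
    z τ hτe hτf hcl
  linear_combination -h

/-- **Superadditivity at `o` ⟺ the double-attachment class is nonnegative**. -/
theorem doubleClass_nonneg_iff {e f : E} {u v : V} (he : ends e = s(o, u))
    (hf : ends f = s(o, v)) (hou : o ≠ u) (hov : o ≠ v) (hef : e ≠ f) (ho1 : o ≠ a₁) (ho2 : o ≠ a₂)
    (ho3 : o ≠ a₃) (hob : o ≠ b) (F : Finset E) (heF : e ∈ F) (hfF : f ∈ F) (z : Config E)
    (τ : E → ℕ) (hτe : τ e = 1) (hτf : τ f = 1)
    (hcl : ∀ e', e' ≠ e → e' ≠ f → o ∈ ends e' → e' ∉ F ∧ z e' = false) [LinearOrder R]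
    [IsStrictOrderedRing R] :
    0 ≤ doubleClass F z τ e f (K3 ends o a₁ a₂ a₃ b : Config E → Config E → Config E → R) ↔
      2 * typedCount (F.erase e) (Function.update z e false) τ (K3 ends o a₁ a₂ a₃ b) +
        2 * typedCount (F.erase f) (Function.update z f false) τ (K3 ends o a₁ a₂ a₃ b) ≤
        typedCount F z τ (K3 ends o a₁ a₂ a₃ b : Config E → Config E → Config E → R) := by
  rw [doubleClass_eq (R := R) ends o a₁ a₂ a₃ b he hf hou hov hef ho1 ho2 ho3 hob F heF hfF z τ hτe hτf hcl]
  constructor <;> intro h <;> linarith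

end Main

end TypedRed

end CovForm

end Summit.Ventures.PercRepro2
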